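import Summits.KontsevichZagierPeriods.KontsevichZagierPeriods.Theorems.LinRedNormalFormWheelThreeSpokesCharts

/-!
# `WheelThreeSpokes` (stmt-KontsevichZagierPeriods-3913), line `laplacian-ldl-chart`:
dehomogenisation (`stub_dehomogenise`)

First move of the chain: the wheel representation `[ℝ₊⁵, 1/Ψ(x)²]` (`Ψ` the typed Kirchhoff
polynomial of `K₄`, `Ψ(x) = det L̃(y)` for the reduced Laplacian `L̃` at
`(y₁₂, y₁₃, y₁₄, y₂₃, y₂₄, y₃₄) = (1, x₄, x₃, x₂, x₁, x₀)`) is ONE change of variables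
(Kontsevich–Zagier rule (2)) away from the same integral written in the projective section
`y₁₂ + y₁₃ + y₁₄ = 1`: `[Z5, 1/Ψᴰ(z)²]`,
`Z5 = {0 < z₀, 0 < z₁, z₀ + z₁ < 1, 0 < z₂, 0 < z₃, 0 < z₄}`,
`Ψᴰ(z) = det L̃(z₀, z₁, 1 − z₀ − z₁, z₂, z₃, z₄)`. The chart is the RATIONAL map
`C(z) = (z₄, z₃, z₂, 1 − z₀ − z₁, z₁)/z₀ : Z5 → ℝ₊⁵` (a bijection, inverse
`z₀ = 1/(1 + x₃ + x₄)`, `(z₁, z₂, z₃, z₄) = z₀·(x₄, x₂, x₁, x₀)`), with Jacobian determinant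
`+1/z₀⁶` and `Ψ(C z) = Ψᴰ(z)/z₀³`, so that `1/Ψᴰ(z)² = (1/Ψ(C z)²)·|1/z₀⁶|`; everything is
packaged by `ratChart_transport` (`P = (X₄, X₃, X₂, 1 − X₀ − X₁, X₁)`, `Qᵢ = X₀`, `J_P = 1`,
`J_Q = X₀⁶`). This file: the semialgebraicity of `Z5`, the values / image / injectivity of the
chart, its Jacobian determinant (the sparse `5 × 5` determinant is expanded along rows), the
pull-back identity, and the stub. No notation is introduced: the set `Z5`, the polynomial
vector `P` and the two integrands are spelled out at each use.

References: M. Kontsevich, D. Zagier, *Periods* (2001), §1.2 rule (2); J. Bochnak, M. Coste,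
M.-F. Roy, *Real Algebraic Geometry* (1998), §2.1.
-/

noncomputable section

open Set MeasureTheory MvPolynomial
open Literature.NumberTheory.Transcendental
open Literature.ModelTheory.ExponentialFields (IsSemialgebraic isSemialgebraic_setOf_eval_lt)

namespace Summit.KontsevichZagierPeriods.LinRedNormalForm.WheelThreeSpokes

namespace Dehomogenise

/-! ### The domain `Z5` -/

/-- `Z5 = {0 < z₀, 0 < z₁, z₀ + z₁ < 1, 0 < z₂, 0 < z₃, 0 < z₄}` is `ℚ`-semialgebraic (six strict
polynomial inequalities). [folklore] -/
theorem isSemialgebraic_Z5 : IsSemialgebraic ℚ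
    {z : Fin 5 → ℝ | 0 < z 0 ∧ 0 < z 1 ∧ z 0 + z 1 < 1 ∧ 0 < z 2 ∧ 0 < z 3 ∧ 0 < z 4} := by
  have h := (((((isSemialgebraic_setOf_eval_lt (k := ℚ) (R := ℝ) (0 : MvPolynomial (Fin 5) ℚ)
    (X 0)).inter (isSemialgebraic_setOf_eval_lt (k := ℚ) (R := ℝ) (0 : MvPolynomial (Fin 5) ℚ)
    (X 1))).inter (isSemialgebraic_setOf_eval_lt (k := ℚ) (R := ℝ) (X 0 + X 1 :
    MvPolynomial (Fin 5) ℚ) 1)).inter (isSemialgebraic_setOf_eval_lt (k := ℚ) (R := ℝ)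
    (0 : MvPolynomial (Fin 5) ℚ) (X 2))).inter (isSemialgebraic_setOf_eval_lt (k := ℚ) (R := ℝ)
    (0 : MvPolynomial (Fin 5) ℚ) (X 3))).inter (isSemialgebraic_setOf_eval_lt (k := ℚ) (R := ℝ)
    (0 : MvPolynomial (Fin 5) ℚ) (X 4))
  have hset : {z : Fin 5 → ℝ | 0 < z 0 ∧ 0 < z 1 ∧ z 0 + z 1 < 1 ∧ 0 < z 2 ∧ 0 < z 3 ∧ 0 < z 4} =
      ((((({x : Fin 5 → ℝ | aeval x (0 : MvPolynomial (Fin 5) ℚ) <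
      aeval x (X 0 : MvPolynomial (Fin 5) ℚ)} ∩ {x : Fin 5 → ℝ |
      aeval x (0 : MvPolynomial (Fin 5) ℚ) < aeval x (X 1 : MvPolynomial (Fin 5) ℚ)}) ∩
      {x : Fin 5 → ℝ | aeval x (X 0 + X 1 :
      MvPolynomial (Fin 5) ℚ) < aeval x (1 : MvPolynomial (Fin 5) ℚ)}) ∩ {x : Fin 5 → ℝ |
      aeval x (0 : MvPolynomial (Fin 5) ℚ) < aeval x (X 2 : MvPolynomial (Fin 5) ℚ)}) ∩
      {x : Fin 5 → ℝ | aeval x (0 : MvPolynomial (Fin 5) ℚ) < aeval x (X 3 :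
      MvPolynomial (Fin 5) ℚ)}) ∩ {x : Fin 5 → ℝ | aeval x (0 : MvPolynomial (Fin 5) ℚ) <
      aeval x (X 4 : MvPolynomial (Fin 5) ℚ)}) := by
    ext z
    simp only [mem_setOf_eq, mem_inter_iff, map_zero, map_one, map_add, aeval_X]
    tauto
  rw [hset]
  exact h

/-- The denominators `Qᵢ = X₀` of the chart do not vanish on `Z5`. [folklore] -/
theorem aeval_Q_ne_zero :
    ∀ y ∈ {z : Fin 5 → ℝ | 0 < z 0 ∧ 0 < z 1 ∧ z 0 + z 1 < 1 ∧ 0 < z 2 ∧ 0 < z 3 ∧ 0 < z 4},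
      ∀ i : Fin 5, aeval y ((fun _ : Fin 5 => (X 0 : MvPolynomial (Fin 5) ℚ)) i) ≠ 0 := by
  rintro y ⟨h0, -, -, -, -, -⟩ _
  simp only [aeval_X]
  exact h0.ne'

/-- The denominator `J_Q = X₀⁶` of the Jacobian determinant does not vanish on `Z5`.
[folklore] -/
theorem aeval_JQ_ne_zero :
    ∀ y ∈ {z : Fin 5 → ℝ | 0 < z 0 ∧ 0 < z 1 ∧ z 0 + z 1 < 1 ∧ 0 < z 2 ∧ 0 < z 3 ∧ 0 < z 4},
      aeval y (X 0 ^ 6 : MvPolynomial (Fin 5) ℚ) ≠ 0 := by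
  rintro y ⟨h0, -, -, -, -, -⟩
  simp only [map_pow, aeval_X]
  exact pow_ne_zero 6 h0.ne'

/-! ### The chart: values, image, injectivity -/

/-- Values of the chart `C(z) = (z₄, z₃, z₂, 1 − z₀ − z₁, z₁)/z₀`. [folklore] -/
theorem chart_apply (z : Fin 5 → ℝ) :
    (fun i => aeval z ((![X 4, X 3, X 2, 1 - X 0 - X 1, X 1] : Fin 5 → MvPolynomial (Fin 5) ℚ) i) /
        aeval z (X 0 : MvPolynomial (Fin 5) ℚ)) =
      ![z 4 / z 0, z 3 / z 0, z 2 / z 0, (1 - z 0 - z 1) / z 0, z 1 / z 0] := by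
  funext i; fin_cases i <;> simp

/-- `C` maps `Z5` onto the open orthant (inverse `z₀ = 1/(1 + x₃ + x₄)`,
`(z₁, z₂, z₃, z₄) = z₀·(x₄, x₂, x₁, x₀)`; `z₀ + z₁ < 1 ⇔ 0 < x₃`). [folklore] -/
theorem image_chart :
    (fun (x : Fin 5 → ℝ) (i : Fin 5) =>
        aeval x ((![X 4, X 3, X 2, 1 - X 0 - X 1, X 1] : Fin 5 → MvPolynomial (Fin 5) ℚ) i) /
          aeval x (X 0 : MvPolynomial (Fin 5) ℚ)) ''
        {z : Fin 5 → ℝ | 0 < z 0 ∧ 0 < z 1 ∧ z 0 + z 1 < 1 ∧ 0 < z 2 ∧ 0 < z 3 ∧ 0 < z 4} =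
      {x : Fin 5 → ℝ | ∀ i, 0 < x i} := by
  ext x
  constructor
  · rintro ⟨z, ⟨h0, h1, h01, h2, h3, h4⟩, rfl⟩
    have h5 : 0 < 1 - z 0 - z 1 := by linarith
    show ∀ i, 0 < (fun i => aeval z ((![X 4, X 3, X 2, 1 - X 0 - X 1, X 1] : Fin 5 →
      MvPolynomial (Fin 5) ℚ) i) / aeval z (X 0 : MvPolynomial (Fin 5) ℚ)) i
    rw [chart_apply]
    intro i
    fin_cases i
    · show 0 < z 4 / z 0; positivity
    · show 0 < z 3 / z 0; positivity
    · show 0 < z 2 / z 0; positivity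
    · show 0 < (1 - z 0 - z 1) / z 0; positivity
    · show 0 < z 1 / z 0; positivity
  · intro hx
    have h0 : 0 < x 0 := hx 0
    have h1 : 0 < x 1 := hx 1
    have h2 : 0 < x 2 := hx 2
    have h3 : 0 < x 3 := hx 3
    have h4 : 0 < x 4 := hx 4
    have hS : 0 < 1 + x 3 + x 4 := by linarith
    refine ⟨![1 / (1 + x 3 + x 4), x 4 / (1 + x 3 + x 4), x 2 / (1 + x 3 + x 4),
      x 1 / (1 + x 3 + x 4), x 0 / (1 + x 3 + x 4)], ?_, ?_⟩
    · show 0 < 1 / (1 + x 3 + x 4) ∧ 0 < x 4 / (1 + x 3 + x 4) ∧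
        1 / (1 + x 3 + x 4) + x 4 / (1 + x 3 + x 4) < 1 ∧ 0 < x 2 / (1 + x 3 + x 4) ∧
        0 < x 1 / (1 + x 3 + x 4) ∧ 0 < x 0 / (1 + x 3 + x 4)
      refine ⟨by positivity, by positivity, ?_, by positivity, by positivity, by positivity⟩
      rw [← add_div, div_lt_one hS]
      linarith
    · beta_reduce
      rw [chart_apply]
      funext i
      fin_cases i
      · show x 0 / (1 + x 3 + x 4) / (1 / (1 + x 3 + x 4)) = x 0
        field_simp
      · show x 1 / (1 + x 3 + x 4) / (1 / (1 + x 3 + x 4)) = x 1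
        field_simp
      · show x 2 / (1 + x 3 + x 4) / (1 / (1 + x 3 + x 4)) = x 2
        field_simp
      · show (1 - 1 / (1 + x 3 + x 4) - x 4 / (1 + x 3 + x 4)) / (1 / (1 + x 3 + x 4)) = x 3
        field_simp
        ring
      · show x 4 / (1 + x 3 + x 4) / (1 / (1 + x 3 + x 4)) = x 4
        field_simp

/-- `C` is injective on `Z5` (`1/z₀ − 1 = x₃ + x₄` recovers `z₀`, then the rest). [folklore] -/
theorem injOn_chart :
    InjOn (fun (x : Fin 5 → ℝ) (i : Fin 5) =>
        aeval x ((![X 4, X 3, X 2, 1 - X 0 - X 1, X 1] : Fin 5 → MvPolynomial (Fin 5) ℚ) i) /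
          aeval x (X 0 : MvPolynomial (Fin 5) ℚ))
      {z : Fin 5 → ℝ | 0 < z 0 ∧ 0 < z 1 ∧ z 0 + z 1 < 1 ∧ 0 < z 2 ∧ 0 < z 3 ∧ 0 < z 4} := by
  intro x hx x' hx' h
  obtain ⟨h0, -, -, -, -, -⟩ := hx
  obtain ⟨h0', -, -, -, -, -⟩ := hx'
  have e0 := congrFun h 0
  have e1 := congrFun h 1
  have e2 := congrFun h 2
  have e3 := congrFun h 3
  have e4 := congrFun h 4
  simp only [Matrix.cons_val_zero, Matrix.cons_val_one, Matrix.cons_val, map_sub, map_one,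
    aeval_X] at e0 e1 e2 e3 e4
  have hx0 : x 0 = x' 0 := by
    have e3' := e3
    have e4' := e4
    rw [div_eq_div_iff h0.ne' h0'.ne'] at e3' e4'
    linear_combination -e3' - e4'
  have hne : x 0 ≠ 0 := h0.ne'
  rw [← hx0] at e0 e1 e2 e4
  funext i
  fin_cases i
  · exact hx0
  · exact (div_left_inj' hne).mp e4
  · exact (div_left_inj' hne).mp e2
  · exact (div_left_inj' hne).mp e1
  · exact (div_left_inj' hne).mp e0

/-! ### The Jacobian determinant -/

/-- The Jacobian matrix `((∂ⱼPᵢ)/Qᵢ − Pᵢ(∂ⱼQᵢ)/Qᵢ²)` of `C`, entrywise. [folklore] -/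
theorem jacobian_eq (y : Fin 5 → ℝ) :
    (Matrix.of fun i j => (aeval y (X 0 : MvPolynomial (Fin 5) ℚ))⁻¹ *
          aeval y (pderiv j ((![X 4, X 3, X 2, 1 - X 0 - X 1, X 1] : Fin 5 →
            MvPolynomial (Fin 5) ℚ) i)) -
        aeval y ((![X 4, X 3, X 2, 1 - X 0 - X 1, X 1] : Fin 5 → MvPolynomial (Fin 5) ℚ) i) /
            aeval y (X 0 : MvPolynomial (Fin 5) ℚ) ^ 2 *
          aeval y (pderiv j (X 0 : MvPolynomial (Fin 5) ℚ)) : Matrix (Fin 5) (Fin 5) ℝ) =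
      Matrix.of ![![-(y 4 / y 0 ^ 2), 0, 0, 0, (y 0)⁻¹],
        ![-(y 3 / y 0 ^ 2), 0, 0, (y 0)⁻¹, 0],
        ![-(y 2 / y 0 ^ 2), 0, (y 0)⁻¹, 0, 0],
        ![-(y 0)⁻¹ - (1 - y 0 - y 1) / y 0 ^ 2, -(y 0)⁻¹, 0, 0, 0],
        ![-(y 1 / y 0 ^ 2), (y 0)⁻¹, 0, 0, 0]] := by
  ext i j
  fin_cases i <;> fin_cases j <;> simp

/-- The sparse `5 × 5` determinant pattern of the Jacobian of `C`: expanding along rows,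
`det = −q⁴(a₃ + a₄)`. [folklore] -/
theorem det_sparse (a₀ a₁ a₂ a₃ a₄ q : ℝ) :
    (Matrix.of ![![a₀, 0, 0, 0, q], ![a₁, 0, 0, q, 0], ![a₂, 0, q, 0, 0], ![a₃, -q, 0, 0, 0],
      ![a₄, q, 0, 0, 0]]).det = -(q ^ 4 * (a₃ + a₄)) := by
  simp only [Matrix.det_succ_row_zero, Matrix.det_isEmpty, Fin.sum_univ_succ, Fin.sum_univ_zero,
    Matrix.submatrix_apply, Matrix.of_apply, Matrix.cons_val_zero, Matrix.cons_val_succ,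
    Fin.zero_succAbove, Fin.succ_succAbove_zero, Fin.succ_succAbove_succ, Fin.val_zero,
    Fin.val_succ, pow_zero, pow_succ]
  ring

/-- Jacobian determinant of `C` on `{z₀ ≠ 0}`: `+1/z₀⁶ = J_P/J_Q` with `J_P = 1`, `J_Q = X₀⁶`.
[folklore] -/
theorem det_chart (y : Fin 5 → ℝ) (hy : y 0 ≠ 0) :
    (Matrix.of fun i j => (aeval y (X 0 : MvPolynomial (Fin 5) ℚ))⁻¹ *
          aeval y (pderiv j ((![X 4, X 3, X 2, 1 - X 0 - X 1, X 1] : Fin 5 →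
            MvPolynomial (Fin 5) ℚ) i)) -
        aeval y ((![X 4, X 3, X 2, 1 - X 0 - X 1, X 1] : Fin 5 → MvPolynomial (Fin 5) ℚ) i) /
            aeval y (X 0 : MvPolynomial (Fin 5) ℚ) ^ 2 *
          aeval y (pderiv j (X 0 : MvPolynomial (Fin 5) ℚ)) : Matrix (Fin 5) (Fin 5) ℝ).det =
      aeval y (1 : MvPolynomial (Fin 5) ℚ) / aeval y (X 0 ^ 6 : MvPolynomial (Fin 5) ℚ) := by
  rw [jacobian_eq, det_sparse]
  simp only [map_one, map_pow, aeval_X]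
  field_simp
  ring

/-! ### The pull-back identity -/

/-- `1/B² = (1/A²)·(1/q⁶)` whenever `A = B/q³`, `q ≠ 0` (no hypothesis on `B`). [folklore] -/
theorem pullback_identity {A B q : ℝ} (hq : q ≠ 0) (h : A = B / q ^ 3) :
    1 / B ^ 2 = 1 / A ^ 2 * (1 / q ^ 6) := by
  subst h
  rw [div_pow, one_div_div, ← pow_mul, div_mul_div_comm, mul_one, mul_comm (B ^ 2), ← div_div,
    div_self (pow_ne_zero _ hq)]

/-- Pull-back identity `g = (h ∘ C)·|J|`: `1/Ψᴰ(z)² = (1/Ψ(C z)²)·|1/z₀⁶|` on `Z5`, from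
`Ψ(C z) = Ψᴰ(z)/z₀³`. [folklore] -/
theorem hgh_chart :
    ∀ z ∈ {z : Fin 5 → ℝ | 0 < z 0 ∧ 0 < z 1 ∧ z 0 + z 1 < 1 ∧ 0 < z 2 ∧ 0 < z 3 ∧ 0 < z 4},
      (fun z : Fin 5 → ℝ => 1 / ((z 0 + z 2 + z 3) * (z 1 + z 2 + z 4) - z 2 ^ 2 -
          z 0 ^ 2 * (z 1 + z 2 + z 4) - 2 * z 0 * z 1 * z 2 - z 1 ^ 2 * (z 0 + z 2 + z 3)) ^ 2) z =
        (fun x : Fin 5 → ℝ => 1 / (x 0 * x 1 * x 3 + x 0 * x 1 * x 4 + x 0 * x 1 +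
          x 0 * x 2 * x 3 + x 0 * x 2 * x 4 + x 0 * x 2 + x 0 * x 3 + x 0 * x 4 + x 1 * x 2 * x 3 +
          x 1 * x 2 * x 4 + x 1 * x 2 + x 1 * x 3 * x 4 + x 1 * x 4 + x 2 * x 3 * x 4 + x 2 * x 3 +
          x 3 * x 4) ^ 2)
          (fun i => aeval z ((![X 4, X 3, X 2, 1 - X 0 - X 1, X 1] : Fin 5 →
            MvPolynomial (Fin 5) ℚ) i) / aeval z (X 0 : MvPolynomial (Fin 5) ℚ)) *
        |aeval z (1 : MvPolynomial (Fin 5) ℚ) / aeval z (X 0 ^ 6 : MvPolynomial (Fin 5) ℚ)| := by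
  rintro z ⟨h0, -, -, -, -, -⟩
  have hz : z 0 ≠ 0 := h0.ne'
  simp only [Matrix.cons_val_zero, Matrix.cons_val_one, Matrix.cons_val, map_sub, map_one,
    map_pow, aeval_X]
  rw [abs_of_pos (by positivity : (0 : ℝ) < 1 / z 0 ^ 6)]
  exact pullback_identity hz (by field_simp; ring)

end Dehomogenise

/-! ### The stub -/

/-- **Dehomogenisation** (stub `stub_dehomogenise` of line `laplacian-ldl-chart`): one change of
variables (rule (2)) along the rational chart `C(z) = (z₄, z₃, z₂, 1 − z₀ − z₁, z₁)/z₀` from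
`Z5 = {0 < z₀, 0 < z₁, z₀ + z₁ < 1, 0 < z₂, 0 < z₃, 0 < z₄}` onto `ℝ₊⁵` (`|J| = 1/z₀⁶`,
`Ψ(C z) = Ψᴰ(z)/z₀³`): (i) from any wheel representation `[ℝ₊⁵, ≡ 1/Ψ²]` a representation
`[Z5, 1/Ψᴰ²]` (absolute integrability transported along `C`); (ii) any `[Z5, ≡ 1/Ψᴰ²]` is
KZ-equivalent to any `[ℝ₊⁵, ≡ 1/Ψ²]`. [cite: KontsevichZagier2001, §1.2 rule (2)] -/
theorem stub_dehomogenise :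
    (∀ r : KZ.IntegralRep 5, r.domain = {x | ∀ i, 0 < x i} →
      Set.EqOn r.integrand (fun x => 1 / (x 0 * x 1 * x 3 + x 0 * x 1 * x 4 + x 0 * x 1 + x 0 * x 2 * x 3 + x 0 * x 2 * x 4 + x 0 * x 2 + x 0 * x 3 + x 0 * x 4 + x 1 * x 2 * x 3 + x 1 * x 2 * x 4 + x 1 * x 2 + x 1 * x 3 * x 4 + x 1 * x 4 + x 2 * x 3 * x 4 + x 2 * x 3 + x 3 * x 4) ^ 2) r.domain →
      ∃ s : KZ.IntegralRep 5, s.domain = {z : Fin 5 → ℝ | 0 < z 0 ∧ 0 < z 1 ∧ z 0 + z 1 < 1 ∧ 0 < z 2 ∧ 0 < z 3 ∧ 0 < z 4} ∧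
        s.integrand = fun z => 1 / ((z 0 + z 2 + z 3) * (z 1 + z 2 + z 4) - z 2 ^ 2 - z 0 ^ 2 * (z 1 + z 2 + z 4) - 2 * z 0 * z 1 * z 2 - z 1 ^ 2 * (z 0 + z 2 + z 3)) ^ 2) ∧
    (∀ s r : KZ.IntegralRep 5, s.domain = {z : Fin 5 → ℝ | 0 < z 0 ∧ 0 < z 1 ∧ z 0 + z 1 < 1 ∧ 0 < z 2 ∧ 0 < z 3 ∧ 0 < z 4} →
      Set.EqOn s.integrand (fun z => 1 / ((z 0 + z 2 + z 3) * (z 1 + z 2 + z 4) - z 2 ^ 2 - z 0 ^ 2 * (z 1 + z 2 + z 4) - 2 * z 0 * z 1 * z 2 - z 1 ^ 2 * (z 0 + z 2 + z 3)) ^ 2) s.domain →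
      r.domain = {x | ∀ i, 0 < x i} →
      Set.EqOn r.integrand (fun x => 1 / (x 0 * x 1 * x 3 + x 0 * x 1 * x 4 + x 0 * x 1 + x 0 * x 2 * x 3 + x 0 * x 2 * x 4 + x 0 * x 2 + x 0 * x 3 + x 0 * x 4 + x 1 * x 2 * x 3 + x 1 * x 2 * x 4 + x 1 * x 2 + x 1 * x 3 * x 4 + x 1 * x 4 + x 2 * x 3 * x 4 + x 2 * x 3 + x 3 * x 4) ^ 2) r.domain →
      KZ.Equivalent s r) := by
  have T := ratChart_transport
    (![X 4, X 3, X 2, 1 - X 0 - X 1, X 1] : Fin 5 → MvPolynomial (Fin 5) ℚ)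
    (fun _ : Fin 5 => (X 0 : MvPolynomial (Fin 5) ℚ)) (1 : MvPolynomial (Fin 5) ℚ) (X 0 ^ 6)
    Dehomogenise.isSemialgebraic_Z5 Dehomogenise.aeval_Q_ne_zero Dehomogenise.aeval_JQ_ne_zero
    (fun y hy => Dehomogenise.det_chart y (ne_of_gt hy.1)) Dehomogenise.injOn_chart
    (fun z : Fin 5 → ℝ => 1 / ((z 0 + z 2 + z 3) * (z 1 + z 2 + z 4) - z 2 ^ 2 -
      z 0 ^ 2 * (z 1 + z 2 + z 4) - 2 * z 0 * z 1 * z 2 - z 1 ^ 2 * (z 0 + z 2 + z 3)) ^ 2)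
    (fun x : Fin 5 → ℝ => 1 / (x 0 * x 1 * x 3 + x 0 * x 1 * x 4 + x 0 * x 1 +
      x 0 * x 2 * x 3 + x 0 * x 2 * x 4 + x 0 * x 2 + x 0 * x 3 + x 0 * x 4 + x 1 * x 2 * x 3 +
      x 1 * x 2 * x 4 + x 1 * x 2 + x 1 * x 3 * x 4 + x 1 * x 4 + x 2 * x 3 * x 4 + x 2 * x 3 +
      x 3 * x 4) ^ 2)
    Dehomogenise.hgh_chart
  obtain ⟨T1, -, T3⟩ := T
  refine ⟨fun r hrd hri => T1 r (hrd.trans Dehomogenise.image_chart.symm) hri,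
    fun s r hsd hsi hrd hri => T3 s r hsd (hsd ▸ hsi)
      (hrd.trans Dehomogenise.image_chart.symm) hri⟩

end Summit.KontsevichZagierPeriods.LinRedNormalForm.WheelThreeSpokes
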